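import Mathlib
import Summits.KontsevichZagierPeriods.Zeta5Search.Families.BasicGrowthClasses
import Summits.KontsevichZagierPeriods.Zeta5Search.Families.ConfigurationClasses
import Summits.KontsevichZagierPeriods.Zeta5Search.Families.BasicGrowthFive
import Summits.KontsevichZagierPeriods.Zeta5Search.Families.BasicGrowthSix
import Summits.KontsevichZagierPeriods.Zeta5Search.Families.CellularBrownZudilin
import Summits.KontsevichZagierPeriods.Zeta5Search.Families.ExactS7aSinkhorn
import Summits.KontsevichZagierPeriods.Zeta5Search.Families.ExactS7bSinkhorn
import Summits.KontsevichZagierPeriods.Zeta5Search.Families.ExactS7cSinkhorn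
import Summits.KontsevichZagierPeriods.Zeta5Search.Families.ExactS7dSinkhorn
import Summits.KontsevichZagierPeriods.Zeta5Search.Families.ExactS7eSinkhorn
import Summits.KontsevichZagierPeriods.Zeta5Search.Families.ExactS8bSinkhorn
import Summits.KontsevichZagierPeriods.Zeta5Search.Families.ExactS8cSinkhorn
import Summits.KontsevichZagierPeriods.Zeta5Search.Families.ExactS8dSinkhorn
import Summits.KontsevichZagierPeriods.Zeta5Search.Families.ExactS8eSinkhorn
import Summits.KontsevichZagierPeriods.Zeta5Search.Families.ExactS8fSinkhorn
import Summits.KontsevichZagierPeriods.Zeta5Search.Families.ExactS8gSinkhorn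
import Summits.KontsevichZagierPeriods.Zeta5Search.Families.ExactS8hSinkhorn
import Summits.KontsevichZagierPeriods.Zeta5Search.Families.ExactS8iSinkhorn
import Summits.KontsevichZagierPeriods.Zeta5Search.Families.ExactS8jSinkhorn
import Summits.KontsevichZagierPeriods.Zeta5Search.Families.ExactS8kSinkhorn
import Summits.KontsevichZagierPeriods.Zeta5Search.Families.ExactS8lSinkhorn
import Summits.KontsevichZagierPeriods.Zeta5Search.Families.ExactS8mSinkhorn
import Summits.KontsevichZagierPeriods.Zeta5Search.Families.ExactS8nSinkhorn
import Summits.KontsevichZagierPeriods.Zeta5Search.Families.ExactS8oSinkhorn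
import Summits.KontsevichZagierPeriods.Zeta5Search.Families.ExactS8pSinkhorn
import Summits.KontsevichZagierPeriods.Zeta5Search.Families.ExactS8qSinkhorn
import HarnessLib

/-!
# ζ(5) search — Families: the exact atlas is COMPLETE for `N ≤ 8` — every convergent seating plan is read off Brown's census lists

HONEST FRAMING: systematic search; no irrationality claim unless certified.  STRUCTURAL facts about the size of
Brown's basic cellular integrals [Brown2016, §1.5, App. 2 §10.1] (seat P2, Families layer); nothing about the
arithmetic of any zeta value.

`Families/BasicGrowthClasses.lean`: the growth constant `M = fSup ∘ ofSeating` is a class function for Brown's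
equivalence; `Families/ConfigurationClasses.lean`: a seating plan of `N ≤ 8` guests is convergent iff it is equivalent to
a printed representative (`reps5`, `reps6`, `reps7`, `reps8`).  Here each printed representative is identified with a
seating of the exact atlas by a dihedral witness (`fSup_eq_of_dihedral`, checked by `decide`), giving:
* **`fSup_ofSeating_five`** — every convergent 5-plan has `M = fSup sigma5` (`= φ^{-5}`, `fSup_sigma5`);
* **`fSup_ofSeating_six`** — every convergent 6-plan has `M = fSup sigma6` (`= (√2−1)^4`, `fSup_sigma6`);
* **`fSup_ofSeating_seven_mem`** — every convergent 7-plan has `M ∈ [M_{S7a}, …, M_{S7e}]`;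
* **`fSup_ofSeating_eight_mem`** — every convergent 8-plan has `M ∈ [M_{₈π₈^∨}, M_{S8b}, …, M_{S8q}]` (17 classes, 13
  values), each an explicit algebraic number by `Families/Exact<Tag>Value.lean` / `BasicGrowthEightExact.lean`.
Standard axioms only.
-/

noncomputable section

open MeasureTheory Set Finset Filter Topology
open Literature.NumberTheory.Irrationality.Brown2016

namespace Summit.KontsevichZagierPeriods.Zeta5Search.Families.Cellular

/-- The printed representative `[5, 2, 4, 1, 3]` (`reps5` no. 1) read 0-based is in the dihedral class of `sigma5`. -/
theorem fSup_reps5_0 : fSup (ofSeating (ℓ := 2) [5, 2, 4, 1, 3]) = fSup sigma5 :=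
  fSup_eq_of_dihedral sigma5_bijective 0 0 false false (by decide)

/-- The printed representative `[6, 2, 4, 1, 5, 3]` (`reps6` no. 1) read 0-based is in the dihedral class of `sigma6`. -/
theorem fSup_reps6_0 : fSup (ofSeating (ℓ := 3) [6, 2, 4, 1, 5, 3]) = fSup sigma6 :=
  fSup_eq_of_dihedral sigma6_bijective 0 1 true true (by decide)

/-- The printed representative `[7, 2, 4, 1, 6, 3, 5]` (`reps7` no. 1) read 0-based is in the dihedral class of `sigmaS7b`. -/
theorem fSup_reps7_0 : fSup (ofSeating (ℓ := 4) [7, 2, 4, 1, 6, 3, 5]) = fSup sigmaS7b :=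
  fSup_eq_of_dihedral sigmaS7b_bijective 0 1 true true (by decide)

/-- The printed representative `[7, 2, 5, 1, 4, 6, 3]` (`reps7` no. 2) read 0-based is in the dihedral class of `sigmaS7d`. -/
theorem fSup_reps7_1 : fSup (ofSeating (ℓ := 4) [7, 2, 5, 1, 4, 6, 3]) = fSup sigmaS7d :=
  fSup_eq_of_dihedral sigmaS7d_bijective 0 6 false false (by decide)

/-- The printed representative `[7, 2, 4, 6, 1, 3, 5]` (`reps7` no. 3) read 0-based is in the dihedral class of `sigmaS7a`. -/
theorem fSup_reps7_2 : fSup (ofSeating (ℓ := 4) [7, 2, 4, 6, 1, 3, 5]) = fSup sigmaS7a :=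
  fSup_eq_of_dihedral sigmaS7a_bijective 0 1 true true (by decide)

/-- The printed representative `[7, 3, 6, 2, 5, 1, 4]` (`reps7` no. 4) read 0-based is in the dihedral class of `sigmaS7e`. -/
theorem fSup_reps7_3 : fSup (ofSeating (ℓ := 4) [7, 3, 6, 2, 5, 1, 4]) = fSup sigmaS7e :=
  fSup_eq_of_dihedral sigmaS7e_bijective 0 1 true true (by decide)

/-- The printed representative `[7, 2, 5, 1, 3, 6, 4]` (`reps7` no. 5) read 0-based is in the dihedral class of `sigmaS7c`. -/
theorem fSup_reps7_4 : fSup (ofSeating (ℓ := 4) [7, 2, 5, 1, 3, 6, 4]) = fSup sigmaS7c :=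
  fSup_eq_of_dihedral sigmaS7c_bijective 0 6 false false (by decide)

/-- The printed representative `[8, 2, 4, 1, 5, 7, 3, 6]` (`reps8` no. 1) read 0-based is in the dihedral class of `sigmaS8e`. -/
theorem fSup_reps8_0 : fSup (ofSeating (ℓ := 5) [8, 2, 4, 1, 5, 7, 3, 6]) = fSup sigmaS8e :=
  fSup_eq_of_dihedral sigmaS8e_bijective 0 7 false false (by decide)

/-- The printed representative `[8, 2, 5, 1, 7, 4, 6, 3]` (`reps8` no. 2) read 0-based is in the dihedral class of `sigmaS8n`. -/
theorem fSup_reps8_1 : fSup (ofSeating (ℓ := 5) [8, 2, 5, 1, 7, 4, 6, 3]) = fSup sigmaS8n :=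
  fSup_eq_of_dihedral sigmaS8n_bijective 0 0 false false (by decide)

/-- The printed representative `[8, 2, 4, 7, 1, 6, 3, 5]` (`reps8` no. 3) read 0-based is in the dihedral class of `sigmaS8c`. -/
theorem fSup_reps8_2 : fSup (ofSeating (ℓ := 5) [8, 2, 4, 7, 1, 6, 3, 5]) = fSup sigmaS8c :=
  fSup_eq_of_dihedral sigmaS8c_bijective 0 7 false false (by decide)

/-- The printed representative `[8, 2, 4, 7, 3, 6, 1, 5]` (`reps8` no. 4) read 0-based is in the dihedral class of `sigmaS8j`. -/
theorem fSup_reps8_3 : fSup (ofSeating (ℓ := 5) [8, 2, 4, 7, 3, 6, 1, 5]) = fSup sigmaS8j :=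
  fSup_eq_of_dihedral sigmaS8j_bijective 0 7 false false (by decide)

/-- The printed representative `[8, 2, 5, 3, 7, 1, 6, 4]` (`reps8` no. 5) read 0-based is in the dihedral class of `sigmaS8o`. -/
theorem fSup_reps8_4 : fSup (ofSeating (ℓ := 5) [8, 2, 5, 3, 7, 1, 6, 4]) = fSup sigmaS8o :=
  fSup_eq_of_dihedral sigmaS8o_bijective 0 0 false false (by decide)

/-- The printed representative `[8, 2, 6, 1, 5, 3, 7, 4]` (`reps8` no. 6) read 0-based is in the dihedral class of `sigmaS8p`. -/
theorem fSup_reps8_5 : fSup (ofSeating (ℓ := 5) [8, 2, 6, 1, 5, 3, 7, 4]) = fSup sigmaS8p :=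
  fSup_eq_of_dihedral sigmaS8p_bijective 0 0 false false (by decide)

/-- The printed representative `[8, 2, 4, 6, 1, 3, 7, 5]` (`reps8` no. 7) read 0-based is in the dihedral class of `sigmaS8b`. -/
theorem fSup_reps8_6 : fSup (ofSeating (ℓ := 5) [8, 2, 4, 6, 1, 3, 7, 5]) = fSup sigmaS8b :=
  fSup_eq_of_dihedral sigmaS8b_bijective 0 7 false false (by decide)

/-- The printed representative `[8, 2, 5, 1, 6, 3, 7, 4]` (`reps8` no. 8) read 0-based is in the dihedral class of `sigmaS8k`. -/
theorem fSup_reps8_7 : fSup (ofSeating (ℓ := 5) [8, 2, 5, 1, 6, 3, 7, 4]) = fSup sigmaS8k :=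
  fSup_eq_of_dihedral sigmaS8k_bijective 0 7 false false (by decide)

/-- The printed representative `[8, 2, 5, 1, 6, 4, 7, 3]` (`reps8` no. 9) read 0-based is in the dihedral class of `sigmaS8h`. -/
theorem fSup_reps8_8 : fSup (ofSeating (ℓ := 5) [8, 2, 5, 1, 6, 4, 7, 3]) = fSup sigmaS8h :=
  fSup_eq_of_dihedral sigmaS8h_bijective 0 7 false false (by decide)

/-- The printed representative `[8, 2, 4, 1, 7, 5, 3, 6]` (`reps8` no. 10) read 0-based is in the dihedral class of `pi8dual`. -/
theorem fSup_reps8_9 : fSup (ofSeating (ℓ := 5) [8, 2, 4, 1, 7, 5, 3, 6]) = fSup pi8dual :=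
  fSup_eq_of_dihedral pi8dual_bijective 0 0 false false (by decide)

/-- The printed representative `[8, 2, 5, 7, 3, 1, 6, 4]` (`reps8` no. 11) read 0-based is in the dihedral class of `sigmaS8d`. -/
theorem fSup_reps8_10 : fSup (ofSeating (ℓ := 5) [8, 2, 5, 7, 3, 1, 6, 4]) = fSup sigmaS8d :=
  fSup_eq_of_dihedral sigmaS8d_bijective 0 7 false false (by decide)

/-- The printed representative `[8, 3, 6, 1, 5, 2, 7, 4]` (`reps8` no. 12) read 0-based is in the dihedral class of `sigmaS8m`. -/
theorem fSup_reps8_11 : fSup (ofSeating (ℓ := 5) [8, 3, 6, 1, 5, 2, 7, 4]) = fSup sigmaS8m :=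
  fSup_eq_of_dihedral sigmaS8m_bijective 0 7 false false (by decide)

/-- The printed representative `[8, 2, 5, 7, 3, 6, 1, 4]` (`reps8` no. 13) read 0-based is in the dihedral class of `sigmaS8i`. -/
theorem fSup_reps8_12 : fSup (ofSeating (ℓ := 5) [8, 2, 5, 7, 3, 6, 1, 4]) = fSup sigmaS8i :=
  fSup_eq_of_dihedral sigmaS8i_bijective 0 7 false false (by decide)

/-- The printed representative `[8, 2, 5, 7, 4, 1, 6, 3]` (`reps8` no. 14) read 0-based is in the dihedral class of `sigmaS8g`. -/
theorem fSup_reps8_13 : fSup (ofSeating (ℓ := 5) [8, 2, 5, 7, 4, 1, 6, 3]) = fSup sigmaS8g :=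
  fSup_eq_of_dihedral sigmaS8g_bijective 0 7 false false (by decide)

/-- The printed representative `[8, 2, 4, 1, 6, 3, 7, 5]` (`reps8` no. 15) read 0-based is in the dihedral class of `sigmaS8f`. -/
theorem fSup_reps8_14 : fSup (ofSeating (ℓ := 5) [8, 2, 4, 1, 6, 3, 7, 5]) = fSup sigmaS8f :=
  fSup_eq_of_dihedral sigmaS8f_bijective 0 7 false false (by decide)

/-- The printed representative `[8, 2, 5, 1, 7, 3, 6, 4]` (`reps8` no. 16) read 0-based is in the dihedral class of `sigmaS8q`. -/
theorem fSup_reps8_15 : fSup (ofSeating (ℓ := 5) [8, 2, 5, 1, 7, 3, 6, 4]) = fSup sigmaS8q :=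
  fSup_eq_of_dihedral sigmaS8q_bijective 0 0 false false (by decide)

/-- The printed representative `[8, 3, 6, 1, 4, 7, 2, 5]` (`reps8` no. 17) read 0-based is in the dihedral class of `sigmaS8l`. -/
theorem fSup_reps8_16 : fSup (ofSeating (ℓ := 5) [8, 3, 6, 1, 4, 7, 2, 5]) = fSup sigmaS8l :=
  fSup_eq_of_dihedral sigmaS8l_bijective 0 1 true true (by decide)

/-- **`N = 5`: every convergent seating plan of five guests has `M = fSup sigma5 = φ^{-5}`.** -/
theorem fSup_ofSeating_five {σ : List ℕ} (hσ : IsSeating 5 σ) (hc : IsConvergent 5 σ) :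
    fSup (ofSeating (ℓ := 2) σ) = fSup sigma5 := by
  obtain ⟨τ, hτ, he⟩ := (isConvergent_five_iff_exists_reps5 hσ).1 hc
  simp only [reps5, List.mem_singleton] at hτ
  subst hτ
  rw [fSup_ofSeating_eq_of_equivalent hσ (by decide) he, fSup_reps5_0]

/-- **`N = 6`: every convergent seating plan of six guests has `M = fSup sigma6 = (√2−1)^4`.** -/
theorem fSup_ofSeating_six {σ : List ℕ} (hσ : IsSeating 6 σ) (hc : IsConvergent 6 σ) :
    fSup (ofSeating (ℓ := 3) σ) = fSup sigma6 := by
  obtain ⟨τ, hτ, he⟩ := (isConvergent_six_iff_exists_reps6 hσ).1 hc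
  simp only [reps6, List.mem_singleton] at hτ
  subst hτ
  rw [fSup_ofSeating_eq_of_equivalent hσ (by decide) he, fSup_reps6_0]

/-- **`N = 7`: the growth constant of every convergent seating plan of seven guests is one of the five atlas values.** -/
theorem fSup_ofSeating_seven_mem {σ : List ℕ} (hσ : IsSeating 7 σ) (hc : IsConvergent 7 σ) :
    fSup (ofSeating (ℓ := 4) σ) ∈ [fSup sigmaS7b, fSup sigmaS7d, fSup sigmaS7a, fSup sigmaS7e, fSup sigmaS7c] := by
  obtain ⟨τ, hτ, he⟩ := (isConvergent_seven_iff_exists_reps7 hσ).1 hc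
  have hτs : IsSeating 7 τ := by
    simp only [reps7, List.mem_cons, List.mem_nil_iff, or_false] at hτ
    rcases hτ with rfl | rfl | rfl | rfl | rfl <;> decide
  rw [fSup_ofSeating_eq_of_equivalent hσ hτs he]
  simp only [reps7, List.mem_cons, List.mem_nil_iff, or_false] at hτ
  rcases hτ with rfl | rfl | rfl | rfl | rfl
  · rw [fSup_reps7_0]; simp
  · rw [fSup_reps7_1]; simp
  · rw [fSup_reps7_2]; simp
  · rw [fSup_reps7_3]; simp
  · rw [fSup_reps7_4]; simp

/-- **`N = 8`: the growth constant of every convergent seating plan of eight guests is one of the seventeen atlas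
values** (thirteen distinct numbers: `M_{S8n} = M_{S8e}`, `M_{S8o} = M_{S8c}`, `M_{S8p} = M_{S8j}`, `M_{S8q} = M_{S8f}`
by their `Value` files), each an explicit algebraic number of degree `≤ 5`. -/
theorem fSup_ofSeating_eight_mem {σ : List ℕ} (hσ : IsSeating 8 σ) (hc : IsConvergent 8 σ) :
    fSup (ofSeating (ℓ := 5) σ) ∈ [fSup sigmaS8e, fSup sigmaS8n, fSup sigmaS8c, fSup sigmaS8j, fSup sigmaS8o, fSup sigmaS8p, fSup sigmaS8b, fSup sigmaS8k, fSup sigmaS8h, fSup pi8dual, fSup sigmaS8d, fSup sigmaS8m, fSup sigmaS8i, fSup sigmaS8g, fSup sigmaS8f, fSup sigmaS8q, fSup sigmaS8l] := by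
  obtain ⟨τ, hτ, he⟩ := (isConvergent_eight_iff_exists_reps8 hσ).1 hc
  rw [fSup_ofSeating_eq_of_equivalent hσ (isSeating_reps8 τ hτ) he]
  simp only [reps8, List.mem_cons, List.mem_nil_iff, or_false] at hτ
  rcases hτ with rfl | rfl | rfl | rfl | rfl | rfl | rfl | rfl | rfl | rfl | rfl | rfl | rfl | rfl | rfl | rfl | rfl
  · rw [fSup_reps8_0]; simp
  · rw [fSup_reps8_1]; simp
  · rw [fSup_reps8_2]; simp
  · rw [fSup_reps8_3]; simp
  · rw [fSup_reps8_4]; simp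
  · rw [fSup_reps8_5]; simp
  · rw [fSup_reps8_6]; simp
  · rw [fSup_reps8_7]; simp
  · rw [fSup_reps8_8]; simp
  · rw [fSup_reps8_9]; simp
  · rw [fSup_reps8_10]; simp
  · rw [fSup_reps8_11]; simp
  · rw [fSup_reps8_12]; simp
  · rw [fSup_reps8_13]; simp
  · rw [fSup_reps8_14]; simp
  · rw [fSup_reps8_15]; simp
  · rw [fSup_reps8_16]; simp

end Summit.KontsevichZagierPeriods.Zeta5Search.Families.Cellular
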